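import Summits.QuantumFields.BalabanUV.T4Continuum.Spine.NE7.QLaBlockAvgEML
import Literature.MathematicalPhysics.QuantumFieldTheory.Balaban1983to89.BlockAveragingFederbush
import Literature.MathematicalPhysics.QuantumFieldTheory.Balaban1983to89.BlockAveragingTwoLevel

/-!
# Spine/NE7/QLaBlockAvgFederbushEML — FEDERBUSH'S IMPLICIT GROUP AVERAGE (0.10) of [Balaban1987RG1] on `SU(N)`
# (`FederbushMean.federbushSU`) TO SECOND ORDER about the identity, in the mass-linear form

Cell `pub-balaban-gaps` (YM blitz Y1, track G2, seat `ne7`, generation 8); text of record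
`run/shared/lean/pub/pub-balaban-gaps/ne/NE7.md` v8, census row R55.  Groundwork for the TWO-LEVEL printed prescription
(0.10)–(0.12) (`IsPrintedAveraged₂ = IsBlockAveraged₂ federbushSU expMeanLogSU`, the second disjunct of the headline's class
`IsPrintedAveraged`): the inner group average of the averaged contour variables (0.11) is Federbush's implicit mean.

WHAT IS PROVED ([folklore] bookkeeping over the tree's `BlockAveragingFederbush`, kernel-checked, 0 sorry):
`norm_fedAvg_sub_one_sub_mean_le`: for a family `W : I → SU(N)` with `dist1 W_i ≤ η`, `2η < δ_Fed = min(1/100, 1/(3N))`,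
`‖M(W) − 1 − |I|⁻¹ Σ_i (W_i − 1)‖ ≤ 336·η·Σ_i dist1 W_i` — from the tree's quantitative (0.8)
`FederbushMean.norm_mlog_fedSol_add_fed_one_le` (`‖log X + |I|⁻¹ Σ_j log W_j X‖`-form, `≤ 35δ²`), the solution's size
`norm_fedSol_sub_one_le` (`≤ 3δ`), its unitarity, and [Balaban1985Averaging] p. 22 (26)–(27) (`MatrixLog`, `B7Prop1Explicit.norm_mlog_sub_le`);
the sup `δ` of the relative family is bounded both by `2η` and by twice the mass, which makes the second-order terms LINEAR in the mass.

HONEST FRAMING.  Elementary estimates on the tree's construction of (0.10); nothing of Bałaban's asserted; the two-level one-step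
analysis itself (census R55) is NOT done here.  (QL-a) NOT IN PRINT; NE7 NOT proved; spine 0∕9; fixed finite T⁴ — NOT ℝ⁴, NOT
infinite volume, NOT a mass gap, NOT Clay.
-/

noncomputable section

open Finset
open scoped BigOperators Matrix Matrix.Norms.L2Operator

namespace Summit.QuantumFields.BalabanUV.T4Continuum.Spine.NE7

open Literature.MathematicalPhysics.QuantumFieldTheory.Balaban1983to89
open Literature.MathematicalPhysics.QuantumFieldTheory.Balaban1983to89.T4Continuum

section SUN

open ExpMeanLog MatrixLog B7Prop1Explicit FederbushMean

variable {n : Type*} [Fintype n] [DecidableEq n] [Nonempty n]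

/-- The relative family of a unitary matrix family about its base member is within (sum of the two deviations) of the identity:
`‖U_j U₀* − 1‖ ≤ ‖U_j − 1‖ + ‖U₀ − 1‖`. [folklore] -/
theorem norm_rel_sub_one_le {m : ℕ} (U : Fin (m + 1) → MatA n) (hU : ∀ j, U j ∈ Matrix.unitaryGroup n ℂ) (j : Fin (m + 1)) :
    ‖rel U 0 j - 1‖ ≤ ‖U j - 1‖ + ‖U 0 - 1‖ := by
  rw [rel_apply]
  refine (B8Ineq170.norm_mul_sub_one_le_of_norm_le_one (le_of_eq (UnitaryModel.norm_of_mem_unitaryGroup (hU j)))).trans ?_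
  rw [norm_star_sub_one]

omit [Nonempty n] in
/-- THE ALGEBRA OF THE BASE POINT: with `M = X* U₀` and `W_j = U_j U₀*` (`U₀` unitary),
`M − 1 − |I|⁻¹Σ_j (U_j − 1) = (X* − 1 − |I|⁻¹Σ_j (W_j − 1))·U₀`. [folklore] -/
theorem fed_base_algebra {m : ℕ} (U : Fin (m + 1) → MatA n) (h0 : star (U 0) * U 0 = 1) (X : MatA n) :
    star X * U 0 - 1 - ((Fintype.card (Fin (m + 1)) : ℂ))⁻¹ • ∑ j, (U j - 1)
      = (star X - 1 - ((Fintype.card (Fin (m + 1)) : ℂ))⁻¹ • ∑ j, (rel U 0 j - 1)) * U 0 := by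
  have hN : ((Fintype.card (Fin (m + 1)) : ℂ)) ≠ 0 := Nat.cast_ne_zero.mpr Fintype.card_ne_zero
  have hrel : ∀ j, (rel U 0 j - 1) * U 0 = U j - U 0 := fun j => by
    rw [rel_apply, sub_mul, one_mul, mul_assoc, h0, mul_one]
  have hmeanconst : ∀ A : MatA n, ((Fintype.card (Fin (m + 1)) : ℂ))⁻¹ • ∑ _j : Fin (m + 1), A = A := fun A => by
    rw [Finset.sum_const, Finset.card_univ, ← Nat.cast_smul_eq_nsmul ℂ, smul_smul, inv_mul_cancel₀ hN, one_smul]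
  have hsum1 : ((Fintype.card (Fin (m + 1)) : ℂ))⁻¹ • ∑ j, (U j - 1)
      = ((Fintype.card (Fin (m + 1)) : ℂ))⁻¹ • ∑ j, U j - 1 := by
    rw [Finset.sum_sub_distrib, smul_sub, hmeanconst]
  have hsum2 : (((Fintype.card (Fin (m + 1)) : ℂ))⁻¹ • ∑ j, (rel U 0 j - 1)) * U 0
      = ((Fintype.card (Fin (m + 1)) : ℂ))⁻¹ • ∑ j, U j - U 0 := by
    rw [smul_mul_assoc, Finset.sum_mul]
    simp_rw [hrel]
    rw [Finset.sum_sub_distrib, smul_sub, hmeanconst]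
  rw [hsum1, sub_mul, sub_mul, one_mul, hsum2]
  abel

/-- **FEDERBUSH'S MEAN TO SECOND ORDER, MASS-LINEAR FORM**: for `W : I → SU(N)` with `dist1 W_i ≤ η`, `2η < δ_Fed`,
`‖M(W) − 1 − |I|⁻¹ Σ_i (W_i − 1)‖ ≤ 336·η·Σ_i dist1 W_i`. [cite: Balaban1987RG1, (0.8) p.253] -/
theorem norm_fedAvg_sub_one_sub_mean_le {ι : Type*} [Fintype ι] [Nonempty ι] (W : ι → Matrix.specialUnitaryGroup n ℂ) {η : ℝ}
    (hη : 2 * η < deltaFed n) (hW : ∀ i, dist1 (W i) ≤ η) :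
    ‖(((federbushSU (n := n)).avg W : Matrix.specialUnitaryGroup n ℂ) : MatA n) - 1
        - ((Fintype.card ι : ℂ))⁻¹ • ∑ i, (((W i : Matrix.specialUnitaryGroup n ℂ) : MatA n) - 1)‖
      ≤ 336 * η * ∑ i, dist1 (W i) := by
  -- re-index through the enumeration
  set e := (LoopAverage.enum ι).symm with he
  set U : Fin (Fintype.card ι - 1 + 1) → MatA n := fun j => ((W (e j) : Matrix.specialUnitaryGroup n ℂ) : MatA n) with hU
  have hUu : ∀ j, U j ∈ Matrix.unitaryGroup n ℂ := fun j => coe_mem_unitaryGroup _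
  have hUn : ∀ j, ‖U j‖ = 1 := fun j => norm_coe_eq_one _
  have ha : ∀ j, ‖U j - 1‖ = dist1 (W (e j)) := fun j => (dist1_eq_norm _).symm
  have hη0 : 0 ≤ η := (GaugeGroup.dist1_nonneg _).trans (hW (Classical.arbitrary ι))
  -- the guard of `fedM`
  have hguard : ∀ i k, ‖U i * star (U k) - 1‖ < deltaFed n := fun i k => by
    calc ‖U i * star (U k) - 1‖ ≤ ‖U i - 1‖ + ‖star (U k) - 1‖ :=
          B8Ineq170.norm_mul_sub_one_le_of_norm_le_one (le_of_eq (hUn i))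
      _ ≤ η + η := by rw [norm_star_sub_one, ha, ha]; exact add_le_add (hW _) (hW _)
      _ < deltaFed n := by linarith
  -- the value of the average on the guard
  have hM : (((federbushSU (n := n)).avg W : Matrix.specialUnitaryGroup n ℂ) : MatA n) = star (fedSol (rel U 0)) * U 0 := by
    show ((fedMSU (W ∘ e) : Matrix.specialUnitaryGroup n ℂ) : MatA n) = _
    rw [coe_fedMSU]
    exact fedM_of_small hguard
  -- masses
  set S : ℝ := ∑ j, ‖U j - 1‖ with hS
  have hS0 : 0 ≤ S := Finset.sum_nonneg fun j _ => norm_nonneg _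
  have haS : ∀ j, ‖U j - 1‖ ≤ S := fun j => Finset.single_le_sum (f := fun j => ‖U j - 1‖) (fun _ _ => norm_nonneg _) (Finset.mem_univ j)
  have hSι : S = ∑ i, dist1 (W i) := by
    rw [hS]; simp_rw [ha]; exact Equiv.sum_comp e (fun i => dist1 (W i))
  set δ' : ℝ := min (2 * η) (2 * S) with hδ'
  have hδ'0 : 0 ≤ δ' := le_min (by linarith) (by linarith)
  have hδ'η : δ' ≤ 2 * η := min_le_left _ _
  have hδ'S : δ' ≤ 2 * S := min_le_right _ _
  have hδ'100 : δ' ≤ 1 / 100 := hδ'η.trans (le_of_lt (hη.trans_le deltaFed_le))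
  have hδ'sq : δ' ^ 2 ≤ 4 * η * S := by
    rw [pow_two]; calc δ' * δ' ≤ (2 * η) * (2 * S) := mul_le_mul hδ'η hδ'S hδ'0 (by linarith)
      _ = 4 * η * S := by ring
  have hWr : ∀ j, ‖rel U 0 j - 1‖ ≤ δ' := fun j => by
    refine le_min ((norm_rel_sub_one_le U hUu j).trans ?_) ((norm_rel_sub_one_le U hUu j).trans ?_)
    · rw [ha, ha]; linarith [hW (e j), hW (e 0)]
    · linarith [haS j, haS 0]
  have hWr100 : ∀ j, ‖rel U 0 j - 1‖ ≤ 1 / 100 := fun j => (hWr j).trans hδ'100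
  set X : MatA n := fedSol (rel U 0) with hX
  have hX1 : ‖X - 1‖ ≤ 3 * δ' := norm_fedSol_sub_one_le hδ'100 hWr
  have hXu : X ∈ Matrix.unitaryGroup n ℂ := fedSol_mem_unitaryGroup (fun j => rel_mem_unitaryGroup hUu 0 j) hWr100
  -- (0.8) quantified
  have F1 : ‖mlog X + ((Fintype.card (Fin (Fintype.card ι - 1 + 1)) : ℂ))⁻¹ • ∑ j, mlog (rel U 0 j)‖ ≤ 35 * δ' ^ 2 := by
    have h := norm_mlog_fedSol_add_fed_one_le hδ'100 hWr
    simpa only [fed, mul_one] using h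
  -- the four second-order pieces
  have T0 : ‖(star X - 1) + (X - 1)‖ ≤ 9 * δ' ^ 2 := by
    have h := norm_inv_sub_one_add_le (g := X) (h := star X) (Unitary.star_mul_self_of_mem hXu)
      (le_of_eq (by rw [norm_star]; exact UnitaryModel.norm_of_mem_unitaryGroup hXu))
    refine h.trans ?_
    calc ‖X - 1‖ ^ 2 = ‖X - 1‖ * ‖X - 1‖ := pow_two _
      _ ≤ (3 * δ') * (3 * δ') := mul_le_mul hX1 hX1 (norm_nonneg _) (by linarith)
      _ = 9 * δ' ^ 2 := by ring
  have T1 : ‖(X - 1) - mlog X‖ ≤ 36 * δ' ^ 2 := by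
    have h6 : ‖X - 1‖ ≤ 1 / 2 := hX1.trans (by linarith)
    have h := norm_mlog_sub_le h6
    rw [norm_sub_rev] at h
    refine h.trans ((expRem_le_sq (by positivity) (by linarith)).trans ?_)
    calc (2 * ‖X - 1‖) ^ 2 = 4 * (‖X - 1‖ * ‖X - 1‖) := by ring
      _ ≤ 4 * ((3 * δ') * (3 * δ')) := by gcongr
      _ = 36 * δ' ^ 2 := by ring
  have T3 : ∀ j, ‖(rel U 0 j - 1) - mlog (rel U 0 j)‖ ≤ 4 * δ' * ‖rel U 0 j - 1‖ := fun j => by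
    have h2 : ‖rel U 0 j - 1‖ ≤ 1 / 2 := (hWr j).trans (hδ'100.trans (by norm_num))
    have h := norm_mlog_sub_le h2
    rw [norm_sub_rev] at h
    refine h.trans ((expRem_le_sq (by positivity) (by linarith [hWr j])).trans ?_)
    calc (2 * ‖rel U 0 j - 1‖) ^ 2 = 4 * ‖rel U 0 j - 1‖ * ‖rel U 0 j - 1‖ := by ring
      _ ≤ 4 * δ' * ‖rel U 0 j - 1‖ := mul_le_mul_of_nonneg_right (by linarith [hWr j]) (norm_nonneg _)
  -- assemble: star X − 1 − mean (W − 1) = [(star X − 1) + (X − 1)] − [(X − 1) − log X] − [log X + mean log W] + mean [log W − (W − 1)]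
  set c : ℂ := ((Fintype.card (Fin (Fintype.card ι - 1 + 1)) : ℂ))⁻¹ with hc
  have hcn : ‖c‖ = (Fintype.card (Fin (Fintype.card ι - 1 + 1)) : ℝ)⁻¹ := by rw [hc, norm_inv, Complex.norm_natCast]
  have hsplit : star X - 1 - c • ∑ j, (rel U 0 j - 1)
      = ((star X - 1) + (X - 1)) - ((X - 1) - mlog X) - (mlog X + c • ∑ j, mlog (rel U 0 j))
        + c • ∑ j, (mlog (rel U 0 j) - (rel U 0 j - 1)) := by
    simp only [Finset.sum_sub_distrib, smul_sub]; abel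
  have T4 : ‖c • ∑ j, (mlog (rel U 0 j) - (rel U 0 j - 1))‖ ≤ 4 * δ' * δ' := by
    rw [norm_smul, hcn]
    have hcard : (0 : ℝ) < Fintype.card (Fin (Fintype.card ι - 1 + 1)) := Nat.cast_pos.mpr Fintype.card_pos
    rw [inv_mul_le_iff₀ hcard]
    calc ‖∑ j, (mlog (rel U 0 j) - (rel U 0 j - 1))‖ ≤ ∑ j, ‖mlog (rel U 0 j) - (rel U 0 j - 1)‖ := norm_sum_le _ _
      _ ≤ ∑ _j : Fin (Fintype.card ι - 1 + 1), 4 * δ' * δ' := Finset.sum_le_sum fun j _ => by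
          rw [norm_sub_rev]; exact (T3 j).trans (mul_le_mul_of_nonneg_left (hWr j) (by positivity))
      _ = Fintype.card (Fin (Fintype.card ι - 1 + 1)) * (4 * δ' * δ') := by
          rw [Finset.sum_const, Finset.card_univ, nsmul_eq_mul]
  have hmain : ‖star X - 1 - c • ∑ j, (rel U 0 j - 1)‖ ≤ 336 * η * S := by
    rw [hsplit]
    calc ‖((star X - 1) + (X - 1)) - ((X - 1) - mlog X) - (mlog X + c • ∑ j, mlog (rel U 0 j))
          + c • ∑ j, (mlog (rel U 0 j) - (rel U 0 j - 1))‖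
        ≤ ‖(star X - 1) + (X - 1)‖ + ‖(X - 1) - mlog X‖ + ‖mlog X + c • ∑ j, mlog (rel U 0 j)‖
          + ‖c • ∑ j, (mlog (rel U 0 j) - (rel U 0 j - 1))‖ := by
          have e1 := norm_add_le (((star X - 1) + (X - 1)) - ((X - 1) - mlog X) - (mlog X + c • ∑ j, mlog (rel U 0 j)))
            (c • ∑ j, (mlog (rel U 0 j) - (rel U 0 j - 1)))
          have e2 := norm_sub_le (((star X - 1) + (X - 1)) - ((X - 1) - mlog X)) (mlog X + c • ∑ j, mlog (rel U 0 j))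
          have e3 := norm_sub_le ((star X - 1) + (X - 1)) ((X - 1) - mlog X)
          linarith
      _ ≤ 9 * δ' ^ 2 + 36 * δ' ^ 2 + 35 * δ' ^ 2 + 4 * δ' * δ' := by linarith [T0, T1, F1, T4]
      _ = 84 * δ' ^ 2 := by ring
      _ ≤ 84 * (4 * η * S) := by linarith [hδ'sq]
      _ = 336 * η * S := by ring
  -- back to the statement
  have h0 : star (U 0) * U 0 = 1 := Unitary.star_mul_self_of_mem (hUu 0)
  have hcard : (Fintype.card (Fin (Fintype.card ι - 1 + 1)) : ℂ) = (Fintype.card ι : ℂ) := by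
    rw [Fintype.card_fin, Nat.sub_add_cancel Fintype.card_pos]
  have hmean : ((Fintype.card ι : ℂ))⁻¹ • ∑ i, (((W i : Matrix.specialUnitaryGroup n ℂ) : MatA n) - 1)
      = c • ∑ j, (U j - 1) := by
    rw [hc, hcard, ← Equiv.sum_comp e (fun i => (((W i : Matrix.specialUnitaryGroup n ℂ) : MatA n) - 1))]
  have halg := fed_base_algebra U h0 X
  rw [← hc] at halg
  rw [hM, hmean, halg, ← hSι]
  calc ‖(star X - 1 - c • ∑ j, (rel U 0 j - 1)) * U 0‖ ≤ ‖star X - 1 - c • ∑ j, (rel U 0 j - 1)‖ * ‖U 0‖ := norm_mul_le _ _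
    _ ≤ 336 * η * S * 1 := by rw [hUn]; exact mul_le_mul_of_nonneg_right hmain zero_le_one
    _ = 336 * η * S := by ring

end SUN

end Summit.QuantumFields.BalabanUV.T4Continuum.Spine.NE7

end
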